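import Summits.CriticalPhenomena.PercolationContinuityZ3.Theorems.FK.EdgeDensityDerivative
import Summits.CriticalPhenomena.PercolationContinuityZ3.Theorems.FK.InfiniteVolumeDefs
import Mathlib.Analysis.SpecialFunctions.Log.Deriv
import HarnessLib

/-!
# FK-continuity cell, FO-10a: the `q`-derivative of the finite-volume random-cluster partition function —
# `d/dq log Z^B_{G}(p,q) = E^B_{G,p,q}[k^B(ω)] / q` (Grimmett 2006, Thm. (3.73)(a), second coordinate of (4.72))

Registered R109 (cell INBOX l.7500, 2026-08-25); registry row FO-10a-g341; label CCL-E (coordinator fk-4 g227).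
Cell `fk-continuity` (bschramm), row FO-10a (pressure layer); support file for the FK-continuity transplant
(`--supports stmt-CriticalPhenomena-4575`); builds on p205010 (kernel theorem, internal audit signed; external expert
review pending). Pure proofs; no definitions, no named facts, no sorries; any finite graph.
UNCONDITIONAL finite-volume structure; it decides nothing about FH / TP_FK / the value of `p_c(q)`.

Grimmett's (4.72): `∇G^ξ_Λ(π,κ) = |E_Λ|⁻¹ (φ^ξ_{Λ,p,q}(|η ∩ E_Λ|), φ^ξ_{Λ,p,q}(k(ω,Λ)))` with `κ = log q`; in the
variable `q` the second coordinate reads `d/dq log Z^ξ_Λ(p,q) = φ^ξ_{Λ,p,q}(k(ω,Λ)) / q`. The tree's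
`EdgeDensityDerivative.lean` has the `p`-direction (Thm. (2.43)); this file gives the `q`-direction for the tree's
finite-volume measure `rcMeasure G p q B` with ONE wired class `B` and its own cluster count `k^B`:

* `hasDerivAt_rcWeight_q` — `d/dq w^B_{p,q}(ω) = w^B_{p,q}(ω) · k^B(ω)/q` (`q ≠ 0`);
* `hasDerivAt_rcPartitionFunction_q` — `d/dq Z^B_G(p,q) = Z^B_G(p,q) · E^B_{G,p,q}[k^B]/q` (`0 ≤ p ≤ 1`, `q > 0`);
* **`hasDerivAt_log_rcPartitionFunction_q`** — `d/dq log Z^B_G(p,q) = E^B_{G,p,q}[k^B]/q`;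
* `hasDerivAt_log_rcPartitionFunction_box_div_q`, `deriv_log_rcPartitionFunction_box_div_q` — the per-site box form
  `d/dq (|Λ_N|⁻¹ log Z^B_{Λ_N}(p,q)) = |Λ_N|⁻¹ E^B_{Λ_N,p,q}[k^B] / q` (any wired class `B` of the box `Λ_N`).

## References

* G. Grimmett, *The Random-Cluster Model*, Springer 2006 (`book:grimmett2006-random-cluster-model`): Thm. (3.73)(a)
  p. 57; §4.5 (4.71)–(4.72) [PDF p. 92]. [Grimmett2006]
-/

noncomputable section

open Finset Filter Topology

namespace Summit.CriticalPhenomena.PercolationContinuityZ3.Theorems.FK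

open Literature.Probability.Percolation Literature.Probability.LatticeModels

/-! ### Any finite graph -/

section Finite

variable {V : Type*} [Fintype V] [DecidableEq V] (G : SimpleGraph V) [DecidableRel G.Adj]

/-- **`d/dq w^B_{p,q}(ω) = w^B_{p,q}(ω) · k^B(ω) / q`** for the random-cluster weight
`w^B_{p,q}(ω) = p^{|ω|} (1−p)^{|E∖ω|} q^{k^B(ω)}` (`q ≠ 0`). [cite: Grimmett2006, Thm. (3.73)(a)] -/
theorem hasDerivAt_rcWeight_q (p : ℝ) (B : Set V) (ω : Finset (Sym2 V)) {q : ℝ} (hq : q ≠ 0) :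
    HasDerivAt (fun r => rcWeight G p r B ω)
      (rcWeight G p q B ω * ((clusterCount (↑ω : BondConfig V) B : ℝ) / q)) q := by
  unfold rcWeight
  have h := (hasDerivAt_pow (clusterCount (↑ω : BondConfig V) B) q).const_mul
    (p ^ #ω * (1 - p) ^ #(G.edgeFinset \ ω))
  refine h.congr_deriv ?_
  rw [natCast_mul_pow_sub_one hq]
  ring

/-- **`d/dq Z^B_G(p,q) = Z^B_G(p,q) · E^B_{G,p,q}[k^B] / q`** (`0 ≤ p ≤ 1`, `q > 0`). [cite: Grimmett2006, Thm. (3.73)(a)] -/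
theorem hasDerivAt_rcPartitionFunction_q {p : ℝ} (hp : p ∈ Set.Icc (0 : ℝ) 1) {q : ℝ} (hq : 0 < q) (B : Set V) :
    HasDerivAt (fun r => rcPartitionFunction G p r B)
      (rcPartitionFunction G p q B *
        (rcExpect G p q B (fun ω => (clusterCount (↑ω : BondConfig V) B : ℝ)) / q)) q := by
  have hZ := (rcPartitionFunction_pos G hp hq B).ne'
  have h : HasDerivAt (fun r => rcPartitionFunction G p r B)
      (∑ ω ∈ G.edgeFinset.powerset, rcWeight G p q B ω * ((clusterCount (↑ω : BondConfig V) B : ℝ) / q)) q := by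
    unfold rcPartitionFunction
    exact HasDerivAt.fun_sum fun ω _ => hasDerivAt_rcWeight_q G p B ω hq.ne'
  refine h.congr_deriv ?_
  rw [rcExpect, mul_div_assoc', Finset.mul_sum, Finset.sum_div]
  refine Finset.sum_congr rfl fun ω _ => ?_
  field_simp

/-- **`d/dq log Z^B_G(p,q) = E^B_{G,p,q}[k^B(ω)] / q`** — the `q`-coordinate of Grimmett's (4.72) for the finite-volume
measure with the wired class `B` (`0 ≤ p ≤ 1`, `q > 0`). [cite: Grimmett2006, Thm. (3.73)(a); (4.72)] -/
theorem hasDerivAt_log_rcPartitionFunction_q {p : ℝ} (hp : p ∈ Set.Icc (0 : ℝ) 1) {q : ℝ} (hq : 0 < q) (B : Set V) :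
    HasDerivAt (fun r => Real.log (rcPartitionFunction G p r B))
      (rcExpect G p q B (fun ω => (clusterCount (↑ω : BondConfig V) B : ℝ)) / q) q := by
  have hZ := (rcPartitionFunction_pos G hp hq B).ne'
  have h := (hasDerivAt_rcPartitionFunction_q G hp hq B).log hZ
  refine h.congr_deriv ?_
  rw [mul_div_cancel_left₀ _ hZ]

end Finite

/-! ### The boxes of `ℤ^d`, per site -/

section Box

variable {d : ℕ} {p : ℝ}

/-- **`d/dq (|Λ_N|⁻¹ log Z^B_{Λ_N}(p,q)) = |Λ_N|⁻¹ E^B_{Λ_N,p,q}[k^B] / q`** for every wired class `B` of the box `Λ_N`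
(`0 ≤ p ≤ 1`, `q > 0`). [cite: Grimmett2006, (4.71)–(4.72)] -/
theorem hasDerivAt_log_rcPartitionFunction_box_div_q (hp : p ∈ Set.Icc (0 : ℝ) 1) {q : ℝ} (hq : 0 < q) {N : ℕ}
    (B : Set ↥(box d N)) :
    HasDerivAt (fun r => Real.log (rcPartitionFunction (finsetGraph (zdGraph d) (box d N)) p r B) / #(box d N))
      (rcExpect (finsetGraph (zdGraph d) (box d N)) p q B
          (fun ω => (clusterCount (↑ω : BondConfig ↥(box d N)) B : ℝ)) / #(box d N) / q) q := by
  have h := (hasDerivAt_log_rcPartitionFunction_q (finsetGraph (zdGraph d) (box d N)) hp hq B).div_const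
    (#(box d N) : ℝ)
  refine h.congr_deriv ?_
  rw [div_right_comm]

/-- The same as a value of `deriv`. [cite: Grimmett2006, (4.71)–(4.72)] -/
theorem deriv_log_rcPartitionFunction_box_div_q (hp : p ∈ Set.Icc (0 : ℝ) 1) {q : ℝ} (hq : 0 < q) {N : ℕ}
    (B : Set ↥(box d N)) :
    deriv (fun r => Real.log (rcPartitionFunction (finsetGraph (zdGraph d) (box d N)) p r B) / #(box d N)) q =
      rcExpect (finsetGraph (zdGraph d) (box d N)) p q B
          (fun ω => (clusterCount (↑ω : BondConfig ↥(box d N)) B : ℝ)) / #(box d N) / q :=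
  (hasDerivAt_log_rcPartitionFunction_box_div_q hp hq B).deriv

end Box

end Summit.CriticalPhenomena.PercolationContinuityZ3.Theorems.FK

end
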